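import Mathlib
import Summits.NavierStokesRegularity.NavierStokesRegularity.Theorems.TaoLadderRungTwoBreakBlowupRigidityOneEnergyBound
import HarnessLib

/-!
# ENERGY CLIMBS ONE BOND AT A TIME: the energy above shell `k` of an exact inviscid cascade flow from a one-shell
  datum is controlled by the SQUARED ACTION of shell `k` — `E_{>k}(t) ≤ (C_A Λ^k ∫₀ᵗ ‖x_k‖²)²`, in particular
  `‖x_{k+1}(t)‖ ≤ C_A Λ^k ∫₀ᵗ ‖x_k(s)‖² ds` — the first brick of «pre-arrival quietness» for the action ceiling (F2a) of
  the front bundle of `stub_eternalFromBlowup` (K2(1) `TaoLadderRungTwoBreak.BlowupRigidityOne`, stmt-NavierStokesRegularity-20206)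

MODEL lattice ODEs only (Tao 2016 §4 (4.3), Lemma 4.1 (4.8)–(4.10)); nothing here is a statement about the Navier–Stokes
equations; NO item is closed (`--supports stmt-NavierStokesRegularity-20206`). Route-independent; general `m`; DEF-FREE.

* `tailEnergy_le_sq_action` — for a cancelling table and an exact flow on `[0,T)` from the one-shell datum `X₀` at shell `0`
  ((4.5)-regular on every `[0,T']`), for every `k ∈ ℕ` and `t ∈ [0,T)`:
  `Σ_i X₀ᵢ² − Σ_{j ≤ k} ‖x_j(t)‖² ≤ (C_A Λ^k ∫₀ᵗ ‖x_k(s)‖² ds)²` (`C_A = fluxConst α`). Proof: the tail `u = E₀ − E_{≤k}`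
  starts at `0`, dominates `‖x_{k+1}‖²` (energy bound `partialEnergy_le_datumEnergy`), and grows only through the flux
  `2Λ^k⟨x_{k+1}, A x_k⟩ ≤ 2 C_A Λ^k ‖x_k‖² √u`; the fence `(∫a + δ(1+τ))²` is never crossed
  (`image_le_of_deriv_right_lt_deriv_boundary`), then `δ → 0`;
* `norm_succ_le_action_sq` — hence `‖x_{k+1}(t)‖ ≤ C_A Λ^k ∫₀ᵗ ‖x_k(s)‖² ds`: NO SPONTANEOUS EMISSION — a shell stays quiet as long
  as the squared action of the shell below is small (the quantitative form of «energy is fed shell after shell»).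

HONEST LABEL: an a-priori estimate for exact cascade flows; it does NOT give the action ceiling (F2a) (that needs the front's
passage time, i.e. lower-bound dynamics); no stub, crux or summit is proved; rung 0.
-/

noncomputable section

-- the summit and its single sub-problem share the name (CONVENTIONS §1)
set_option linter.dupNamespace false

open Set Filter Topology MeasureTheory intervalIntegral
open scoped RealInnerProductSpace

namespace Summit.NavierStokesRegularity.NavierStokesRegularity.Theorems

namespace BlowupRigidityOne

open Literature.Analysis.FluidPDE Literature.Analysis.FluidPDE.TaoCascade

variable {m : ℕ}

/-- **ENERGY CLIMBING: the tail energy above shell `k` is bounded by the squared `L²`-action of shell `k`.**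
[cite: Tao2016AveragedNS, §4 (4.3) (cancellation), Lemma 4.1 (4.8)–(4.10) (shell energy balance, flux `(1+ε₀)^{5n/2} X_{n+1} X_n²`); §1.2 (energy transfer shell by shell)] -/
theorem tailEnergy_le_sq_action {ε₀ T : ℝ} (hε : 0 < ε₀)
    {α : Fin m → Fin m → Fin m → ℤ × ℤ × ℤ → ℝ} (hc : IsCancellingCoeff α)
    {X : Fin m → ℤ → ℝ → ℝ} {X₀ : Fin m → ℝ}
    (hder : ∀ i k, ∀ t ∈ Ico 0 T, HasDerivWithinAt (X i k) (quadTerm ε₀ α X i k t) (Ici 0) t)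
    (hinit : ∀ i k, X i k 0 = if k = 0 then X₀ i else 0)
    (hlow : ∀ i k t, k < 0 → X i k t = 0)
    (hreg : ∀ T' : ℝ, T' < T → ∃ M : ℝ, ∀ t ∈ Icc 0 T', ∀ (i : Fin m) (k : ℤ),
      (1 + (1 + ε₀) ^ ((10 : ℝ) * k)) * |X i k t| ≤ M)
    (k : ℕ) : ∀ t ∈ Ico 0 T,
      (∑ i, X₀ i ^ 2) - ∑ j ∈ Finset.range (k + 1), ‖shellVec X (j : ℤ) t‖ ^ 2 ≤
        (fluxConst α * bigLam ε₀ ^ k * ∫ s in (0 : ℝ)..t, ‖shellVec X (k : ℤ) s‖ ^ 2) ^ 2 := by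
  intro t ht
  have hL : 0 < bigLam ε₀ := bigLam_pos (by linarith)
  have hS := table_sTable α hc
  have hCA : 0 ≤ fluxConst α := fluxConst_nonneg α
  -- the flux `f τ = 2 Λ^k ⟪x_{k+1}, A x_k⟫` and the tail `u = E₀ - S_k`
  set f : ℝ → ℝ := fun τ => 2 * bigLam ε₀ ^ (k : ℤ) * ⟪shellVec X ((k : ℤ) + 1) τ, tableA α (shellVec X (k : ℤ) τ)⟫
    with hfdef
  set Sk : ℝ → ℝ := fun τ => ∑ j ∈ Finset.range (k + 1), ‖shellVec X (j : ℤ) τ‖ ^ 2 with hSkdef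
  set E₀ : ℝ := ∑ i, X₀ i ^ 2 with hE₀
  set u : ℝ → ℝ := fun τ => E₀ - Sk τ with hudef
  -- shells below `0` vanish
  have hxneg : ∀ τ, shellVec X (-1) τ = 0 := fun τ => by
    ext i; simp [shellVec, hlow i (-1) τ (by norm_num)]
  -- derivative of `S_k`: telescoping to `-f`
  have hSder : ∀ τ ∈ Ico (0 : ℝ) T, HasDerivWithinAt Sk (-(f τ)) (Ici 0) τ := by
    intro τ hτ
    set g : ℤ → ℝ := fun j => 2 * bigLam ε₀ ^ j * ⟪shellVec X (j + 1) τ, tableA α (shellVec X j τ)⟫ with hgdef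
    have hterm : ∀ j ∈ Finset.range (k + 1), HasDerivWithinAt (fun s => ‖shellVec X (j : ℤ) s‖ ^ 2)
        (g ((j : ℤ) - 1) - g j) (Ici 0) τ := by
      intro j _
      have h := shellEnergy_hasDerivWithinAt hε hc (k := (j : ℤ)) (fun i => hder i j τ hτ)
      simp only [hgdef, sub_add_cancel]
      exact h
    have hsum := HasDerivWithinAt.sum hterm
    have hg1 : g (-1) = 0 := by
      simp only [hgdef]
      rw [hxneg, tableA_zero hc, inner_zero_right, mul_zero]
    have htel : ∑ j ∈ Finset.range (k + 1), (g ((j : ℤ) - 1) - g j) = -(f τ) := by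
      have h := Finset.sum_range_sub' (fun j : ℕ => g ((j : ℤ) - 1)) (k + 1)
      have e : ∀ j : ℕ, g (((j + 1 : ℕ) : ℤ) - 1) = g (j : ℤ) := fun j => by
        congr 1; push_cast; ring
      simp only [e] at h
      rw [h]
      push_cast
      rw [hg1, zero_sub]
    rw [htel, Finset.sum_fn] at hsum
    exact hsum
  have huder : ∀ τ ∈ Ico (0 : ℝ) T, HasDerivWithinAt u (f τ) (Ici 0) τ := by
    intro τ hτ
    have h := (hSder τ hτ).const_sub E₀
    rw [neg_neg] at h
    exact h
  -- `u(0) = 0` and `‖x_{k+1}‖² ≤ u`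
  have hSk0 : Sk 0 = E₀ := by
    simp only [hSkdef, hE₀]
    rw [Finset.sum_eq_single 0]
    · rw [EuclideanSpace.norm_eq, Real.sq_sqrt (Finset.sum_nonneg fun i _ => by positivity)]
      refine Finset.sum_congr rfl fun i _ => ?_
      simp [shellVec, hinit]
    · intro j _ hj
      have : shellVec X (j : ℤ) 0 = 0 := by
        ext i
        simp [shellVec, hinit, hj]
      rw [this, norm_zero, zero_pow two_ne_zero]
    · intro h; exact absurd (Finset.mem_range.2 (Nat.succ_pos k)) h
  have hu0 : u 0 = 0 := by simp only [hudef, hSk0, sub_self]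
  have hxu : ∀ τ ∈ Ico (0 : ℝ) T, ‖shellVec X ((k : ℤ) + 1) τ‖ ^ 2 ≤ u τ := by
    intro τ hτ
    have hE := partialEnergy_le_datumEnergy hε hc hder hinit hlow hreg τ hτ (k + 1)
    rw [Finset.sum_range_succ] at hE
    simp only [hudef, hSkdef, hE₀]
    push_cast at hE ⊢
    linarith
  -- the source `a τ = C_A Λ^k ‖x_k τ‖²`, made globally continuous by clamping time to `[0,t]`
  have hcx : ∀ j : ℤ, ContinuousOn (fun s => shellVec X j s) (Ico 0 T) := by
    intro j
    have hcp : ContinuousOn (fun s => fun i => X i j s) (Ico 0 T) :=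
      continuousOn_pi.2 fun i s hs => ((hder i j s hs).continuousWithinAt).mono fun x hx => hx.1
    exact (PiLp.continuous_toLp 2 (fun _ : Fin m => ℝ)).comp_continuousOn hcp
  set a : ℝ → ℝ := fun τ => fluxConst α * bigLam ε₀ ^ (k : ℤ) * ‖shellVec X (k : ℤ) τ‖ ^ 2 with hadef
  have ha0 : ∀ τ, 0 ≤ a τ := fun τ => by simp only [hadef]; positivity
  set proj : ℝ → ℝ := fun τ => max 0 (min τ t) with hproj
  have hproj_mem : ∀ τ, proj τ ∈ Ico (0 : ℝ) T := fun τ =>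
    ⟨le_max_left _ _, lt_of_le_of_lt (max_le ht.1 (min_le_right _ _)) ht.2⟩
  have hproj_id : ∀ τ ∈ Icc (0 : ℝ) t, proj τ = τ := fun τ hτ => by
    simp only [hproj]; rw [min_eq_left hτ.2, max_eq_right hτ.1]
  have hproj_cont : Continuous proj := continuous_const.max (continuous_id.min continuous_const)
  set at' : ℝ → ℝ := fun τ => a (proj τ) with hat'
  have hacont : Continuous at' := by
    have h1 : ContinuousOn a (Ico 0 T) := by
      simp only [hadef]
      exact (continuousOn_const.mul ((hcx k).norm.pow 2))
    exact h1.comp_continuous hproj_cont hproj_mem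
  have hat'0 : ∀ τ, 0 ≤ at' τ := fun τ => ha0 _
  have hat'_eq : ∀ τ ∈ Icc (0 : ℝ) t, at' τ = a τ := fun τ hτ => by
    show a (proj τ) = a τ
    rw [hproj_id τ hτ]
  -- its primitive
  set I : ℝ → ℝ := fun τ => ∫ s in (0 : ℝ)..τ, at' s with hIdef
  have hIder : ∀ τ, HasDerivAt I (at' τ) τ := fun τ =>
    integral_hasDerivAt_right (hacont.intervalIntegrable _ _) (hacont.stronglyMeasurableAtFilter _ _)
      hacont.continuousAt
  have hI0 : ∀ τ, 0 ≤ τ → 0 ≤ I τ := fun τ hτ => intervalIntegral.integral_nonneg hτ fun s _ => hat'0 s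
  -- the fence `B_δ = (I + δ(1+τ))²`
  have hfence : ∀ δ : ℝ, 0 < δ → u t ≤ (I t + δ * (1 + t)) ^ 2 := by
    intro δ hδ
    set B : ℝ → ℝ := fun τ => (I τ + δ * (1 + τ)) ^ 2 with hBdef
    set B' : ℝ → ℝ := fun τ => 2 * (I τ + δ * (1 + τ)) * (at' τ + δ) with hB'def
    have hBder : ∀ τ, HasDerivAt B (B' τ) τ := by
      intro τ
      have h2 : HasDerivAt (fun τ => δ * (1 + τ)) (δ * 1) τ :=
        ((hasDerivAt_id τ).const_add 1).const_mul δ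
      have h1 : HasDerivAt (fun τ => I τ + δ * (1 + τ)) (at' τ + δ * 1) τ := (hIder τ).add h2
      have h4 := h1.pow 2
      refine h4.congr_deriv ?_
      simp only [hB'def]
      push_cast
      ring
    have hcontu : ContinuousOn u (Icc 0 t) := fun τ hτ =>
      ((huder τ ⟨hτ.1, lt_of_le_of_lt hτ.2 ht.2⟩).continuousWithinAt).mono Icc_subset_Ici_self
    have hf' : ∀ τ ∈ Ico (0 : ℝ) t, HasDerivWithinAt u (f τ) (Ici τ) τ := fun τ hτ =>
      (huder τ ⟨hτ.1, lt_trans hτ.2 ht.2⟩).mono (Ici_subset_Ici.2 hτ.1)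
    have hstart : u 0 ≤ B 0 := by rw [hu0]; simp only [hBdef]; positivity
    have hbound : ∀ τ ∈ Ico (0 : ℝ) t, u τ = B τ → f τ < B' τ := by
      intro τ hτ heq
      have hτT : τ ∈ Ico (0 : ℝ) T := ⟨hτ.1, lt_trans hτ.2 ht.2⟩
      have hpos : 0 < I τ + δ * (1 + τ) := by
        have := hI0 τ hτ.1
        nlinarith [hτ.1]
      -- `‖x_{k+1}‖ ≤ √u = I + δ(1+τ)`
      have hx1 : ‖shellVec X ((k : ℤ) + 1) τ‖ ≤ I τ + δ * (1 + τ) := by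
        have h := hxu τ hτT
        rw [heq] at h
        exact (pow_le_pow_iff_left₀ (norm_nonneg _) hpos.le two_ne_zero).1 h
      -- the flux bound
      have hflux : f τ ≤ 2 * (I τ + δ * (1 + τ)) * at' τ := by
        rw [hat'_eq τ ⟨hτ.1, hτ.2.le⟩]
        have hA := hS.normA (shellVec X (k : ℤ) τ)
        have h1 : ⟪shellVec X ((k : ℤ) + 1) τ, tableA α (shellVec X (k : ℤ) τ)⟫ ≤
            (I τ + δ * (1 + τ)) * (fluxConst α * ‖shellVec X (k : ℤ) τ‖ ^ 2) :=
          (le_abs_self _).trans ((abs_real_inner_le_norm _ _).trans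
            (mul_le_mul hx1 hA (norm_nonneg _) hpos.le))
        simp only [hfdef, hadef]
        have hLk : 0 < bigLam ε₀ ^ (k : ℤ) := zpow_pos hL _
        nlinarith
      have hstrict : 2 * (I τ + δ * (1 + τ)) * at' τ < B' τ := by
        simp only [hB'def]
        nlinarith [hat'0 τ]
      exact lt_of_le_of_lt hflux hstrict
    have key := image_le_of_deriv_right_lt_deriv_boundary hcontu hf' hstart hBder hbound
      (right_mem_Icc.2 ht.1)
    simpa only [hBdef] using key
  -- `δ → 0`
  have hIt : I t = fluxConst α * bigLam ε₀ ^ k * ∫ s in (0 : ℝ)..t, ‖shellVec X (k : ℤ) s‖ ^ 2 := by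
    have h1 : I t = ∫ s in (0 : ℝ)..t, a s := by
      refine intervalIntegral.integral_congr fun s hs => ?_
      rw [uIcc_of_le ht.1] at hs
      exact hat'_eq s hs
    rw [h1, ← intervalIntegral.integral_const_mul]
    refine intervalIntegral.integral_congr fun s _ => ?_
    show a s = fluxConst α * bigLam ε₀ ^ k * ‖shellVec X (k : ℤ) s‖ ^ 2
    rw [hadef, zpow_natCast]
  have hlim : Tendsto (fun δ : ℝ => (I t + δ * (1 + t)) ^ 2) (𝓝[>] 0) (𝓝 ((I t + 0 * (1 + t)) ^ 2)) := by
    have h : Continuous fun δ : ℝ => (I t + δ * (1 + t)) ^ 2 :=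
      (continuous_const.add (continuous_id.mul continuous_const)).pow 2
    exact (h.tendsto 0).mono_left nhdsWithin_le_nhds
  rw [zero_mul, add_zero] at hlim
  have hut : u t ≤ I t ^ 2 :=
    ge_of_tendsto hlim (eventually_nhdsWithin_of_forall fun δ hδ => hfence δ hδ)
  rw [hIt] at hut
  simpa only [hudef, hSkdef, hE₀] using hut

/-- **NO SPONTANEOUS EMISSION**: `‖x_{k+1}(t)‖ ≤ C_A Λ^k ∫₀ᵗ ‖x_k(s)‖² ds` for the exact flow from a one-shell datum at shell `0`.
[cite: Tao2016AveragedNS, §4 (4.3), Lemma 4.1 (4.8)–(4.10); §1.2] -/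
theorem norm_succ_le_action_sq {ε₀ T : ℝ} (hε : 0 < ε₀)
    {α : Fin m → Fin m → Fin m → ℤ × ℤ × ℤ → ℝ} (hc : IsCancellingCoeff α)
    {X : Fin m → ℤ → ℝ → ℝ} {X₀ : Fin m → ℝ}
    (hder : ∀ i k, ∀ t ∈ Ico 0 T, HasDerivWithinAt (X i k) (quadTerm ε₀ α X i k t) (Ici 0) t)
    (hinit : ∀ i k, X i k 0 = if k = 0 then X₀ i else 0)
    (hlow : ∀ i k t, k < 0 → X i k t = 0)
    (hreg : ∀ T' : ℝ, T' < T → ∃ M : ℝ, ∀ t ∈ Icc 0 T', ∀ (i : Fin m) (k : ℤ),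
      (1 + (1 + ε₀) ^ ((10 : ℝ) * k)) * |X i k t| ≤ M)
    (k : ℕ) : ∀ t ∈ Ico 0 T,
      ‖shellVec X ((k : ℤ) + 1) t‖ ≤ fluxConst α * bigLam ε₀ ^ k * ∫ s in (0 : ℝ)..t, ‖shellVec X (k : ℤ) s‖ ^ 2 := by
  intro t ht
  have hL : 0 < bigLam ε₀ := bigLam_pos (by linarith)
  have htail := tailEnergy_le_sq_action hε hc hder hinit hlow hreg k t ht
  have hE := partialEnergy_le_datumEnergy hε hc hder hinit hlow hreg t ht (k + 1)
  rw [Finset.sum_range_succ] at hE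
  push_cast at hE
  have hsq : ‖shellVec X ((k : ℤ) + 1) t‖ ^ 2 ≤
      (fluxConst α * bigLam ε₀ ^ k * ∫ s in (0 : ℝ)..t, ‖shellVec X (k : ℤ) s‖ ^ 2) ^ 2 := by linarith
  have hnn : 0 ≤ fluxConst α * bigLam ε₀ ^ k * ∫ s in (0 : ℝ)..t, ‖shellVec X (k : ℤ) s‖ ^ 2 := by
    have h0 : 0 ≤ ∫ s in (0 : ℝ)..t, ‖shellVec X (k : ℤ) s‖ ^ 2 :=
      intervalIntegral.integral_nonneg ht.1 (fun s _ => sq_nonneg ‖shellVec X (k : ℤ) s‖)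
    have hCA := fluxConst_nonneg α
    positivity
  exact (pow_le_pow_iff_left₀ (norm_nonneg _) hnn two_ne_zero).1 hsq

end BlowupRigidityOne

end Summit.NavierStokesRegularity.NavierStokesRegularity.Theorems

end
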